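import Mathlib
import Summits.NavierStokesRegularity.NavierStokesRegularity.Theorems.FilamentSkeletonRssAnalyticStripLiaSymbolSeriesExp

/-!
# Stub P3 `LiaSymbolBound` — KERNEL-ONLY numerics, brick 2: the FAR parts (`t ≥ 1`) of `E(p) = ∫₀^∞ e^{−t−p/t}dt/t` and
# `C(p) = ∫₀^∞ e^{−t−p/t}dt` as alternating series in `p` with the incomplete-gamma moments `β_k = ∫₁^∞ e^{−t} t^{−k} dt`

Hand leafhand-ns-filamentskeletonrs-7 g1 (prover), 2026-08-31, `--supports stmt-NavierStokesRegularity-23320 --as helper` (tenure P5-(B),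
scoped by leafhand-7-g0: replace the `native_decide` behind `…NumericsCert.numerics_window`).  Def-free, standard axioms.
* §1 `β_k = ∫_{(1,∞)} e^{−t} t^{−k}`: integrability, `β₀ = e^{−1}`, `β₁ = E₁(1)` (`Literature…expIntegralE1`), and the integration-by-parts
  recurrence `β_k + k·β_{k+1} = e^{−1}` (`k ≥ 1`) — so every `β_k` is an explicit affine function of `e^{−1}` and `E₁(1) = Ein 1 − γ`;
* §2 `far_expansion`: for `p ≥ 0` and every `j, n`,
  `0 ≤ (−1)^n·(∫_{(1,∞)} e^{−t}t^{−j}e^{−p/t} − Σ_{k<n} (−p)^k/k!·β_{k+j}) ≤ pⁿ/n!·β_{n+j}`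
  (termwise integration of the alternating Taylor enclosure of `e^{−p/t}`, brick 1); `j = 1` is the far part of `E`, `j = 0` that of `C`.

HONEST FRAMING: elementary real analysis serving certified numerics for one explicit real integral of a HYPOTHETICAL filament-skeleton line
on the NEGATIVE side of a MODEL route; nothing here bears on Navier–Stokes regularity or blow-up.
-/

set_option linter.dupNamespace false

noncomputable section

namespace Summit.NavierStokesRegularity.NavierStokesRegularity.Theorems.AnalyticStripLiaSymbol

namespace Series

open Real Set MeasureTheory Filter Topology Finset
open Literature.NumberTheory.Sieve

/-! ## §1  The moments `β_k = ∫₁^∞ e^{−t} t^{−k} dt` -/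

/-- Continuity of the far integrand `e^{−t} t^{−j} e^{−p/t}` on `(1, ∞)`. -/
theorem continuousOn_far (j : ℕ) (p : ℝ) :
    ContinuousOn (fun t : ℝ => Real.exp (-t) * t ^ (-(j:ℤ)) * Real.exp (-(p / t))) (Ioi 1) := by
  intro t ht
  have ht0 : t ≠ 0 := by have : (1:ℝ) < t := ht; positivity
  apply ContinuousAt.continuousWithinAt
  have h1 : ContinuousAt (fun t : ℝ => Real.exp (-t)) t := (Real.continuous_exp.comp continuous_neg).continuousAt
  have h2 : ContinuousAt (fun t : ℝ => t ^ (-(j:ℤ))) t := continuousAt_zpow₀ t _ (Or.inl ht0)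
  have h3 : ContinuousAt (fun t : ℝ => Real.exp (-(p / t))) t :=
    Real.continuous_exp.continuousAt.comp ((continuousAt_const.div continuousAt_id ht0).neg)
  exact (h1.mul h2).mul h3

/-- Pointwise bound of the far integrand by `e^{−t}` on `(1, ∞)` (`p ≥ 0`). -/
theorem far_integrand_le (j : ℕ) {p t : ℝ} (hp : 0 ≤ p) (ht : 1 < t) :
    0 ≤ Real.exp (-t) * t ^ (-(j:ℤ)) * Real.exp (-(p / t)) ∧
      Real.exp (-t) * t ^ (-(j:ℤ)) * Real.exp (-(p / t)) ≤ Real.exp (-t) := by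
  have ht0 : 0 < t := by linarith
  have hz : 0 ≤ t ^ (-(j:ℤ)) := zpow_nonneg ht0.le _
  have hz1 : t ^ (-(j:ℤ)) ≤ 1 := zpow_le_one_of_nonpos₀ ht.le (by simp)
  have he : Real.exp (-(p / t)) ≤ 1 := by rw [Real.exp_le_one_iff]; exact neg_nonpos.mpr (div_nonneg hp ht0.le)
  refine ⟨by positivity, ?_⟩
  calc Real.exp (-t) * t ^ (-(j:ℤ)) * Real.exp (-(p / t)) ≤ Real.exp (-t) * 1 * 1 := by
        gcongr
    _ = Real.exp (-t) := by ring

/-- Integrability of the far integrand on `(1, ∞)` (`p ≥ 0`). -/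
theorem integrableOn_far (j : ℕ) {p : ℝ} (hp : 0 ≤ p) :
    IntegrableOn (fun t : ℝ => Real.exp (-t) * t ^ (-(j:ℤ)) * Real.exp (-(p / t))) (Ioi 1) := by
  refine (integrableOn_exp_neg_Ioi 1).mono' ((continuousOn_far j p).aestronglyMeasurable measurableSet_Ioi) ?_
  rw [ae_restrict_iff' measurableSet_Ioi]
  refine Filter.Eventually.of_forall fun t (ht : 1 < t) => ?_
  have h := far_integrand_le j hp ht
  rw [Real.norm_eq_abs, abs_of_nonneg h.1]
  exact h.2

/-- Integrability of `e^{−t} t^{−k}` on `(1, ∞)`. -/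
theorem integrableOn_beta (k : ℕ) :
    IntegrableOn (fun t : ℝ => Real.exp (-t) * t ^ (-(k:ℤ))) (Ioi 1) := by
  have h := integrableOn_far k (le_refl (0:ℝ))
  refine h.congr_fun (fun t _ => ?_) measurableSet_Ioi
  simp

/-- `β_k ≥ 0`. -/
theorem beta_nonneg (k : ℕ) : 0 ≤ ∫ t in Ioi (1:ℝ), Real.exp (-t) * t ^ (-(k:ℤ)) :=
  setIntegral_nonneg measurableSet_Ioi fun t (ht : 1 < t) =>
    mul_nonneg (Real.exp_pos _).le (zpow_nonneg (by linarith) _)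

/-- `β₀ = e^{−1}`. -/
theorem beta_zero : ∫ t in Ioi (1:ℝ), Real.exp (-t) * t ^ (-((0:ℕ):ℤ)) = Real.exp (-1) := by
  rw [show (fun t : ℝ => Real.exp (-t) * t ^ (-((0:ℕ):ℤ))) = fun t => Real.exp (-t) by funext t; simp]
  exact integral_exp_neg_Ioi 1

/-- `β₁ = E₁(1)`. -/
theorem beta_one : ∫ t in Ioi (1:ℝ), Real.exp (-t) * t ^ (-((1:ℕ):ℤ)) = expIntegralE1 1 := by
  rw [expIntegralE1]
  refine setIntegral_congr_fun measurableSet_Ioi (fun t _ => ?_)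
  simp [zpow_neg, div_eq_mul_inv]

/-- **The recurrence** `β_k + k·β_{k+1} = e^{−1}` for `k ≥ 1` (integration by parts on `[1, ∞)`; also true, trivially unused, for `k = 0`). -/
theorem beta_succ (k : ℕ) :
    (∫ t in Ioi (1:ℝ), Real.exp (-t) * t ^ (-(k:ℤ)))
      + (k:ℝ) * ∫ t in Ioi (1:ℝ), Real.exp (-t) * t ^ (-((k + 1 : ℕ):ℤ)) = Real.exp (-1) := by
  set f : ℝ → ℝ := fun t => -(Real.exp (-t) * t ^ (-(k:ℤ))) with hf
  set f' : ℝ → ℝ := fun t => Real.exp (-t) * t ^ (-(k:ℤ)) + (k:ℝ) * (Real.exp (-t) * t ^ (-((k + 1 : ℕ):ℤ))) with hf'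
  have hderiv : ∀ t ∈ Ioi (1:ℝ), HasDerivAt f (f' t) t := by
    intro t ht
    have ht0 : t ≠ 0 := by have : (1:ℝ) < t := ht; positivity
    have h1 : HasDerivAt (fun t : ℝ => Real.exp (-t)) (-Real.exp (-t)) t := by
      simpa using (hasDerivAt_neg t).exp
    have h2 : HasDerivAt (fun t : ℝ => t ^ (-(k:ℤ))) (((-(k:ℤ) : ℤ) : ℝ) * t ^ (-(k:ℤ) - 1)) t :=
      hasDerivAt_zpow (-(k:ℤ)) t (Or.inl ht0)
    refine ((h1.mul h2).neg).congr_deriv ?_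
    have hexp : (-(k:ℤ) - 1) = -((k + 1 : ℕ):ℤ) := by push_cast; ring
    rw [hexp, hf']
    push_cast
    ring
  have hcont : ContinuousWithinAt f (Ici 1) 1 := by
    apply ContinuousAt.continuousWithinAt
    have h2 : ContinuousAt (fun t : ℝ => t ^ (-(k:ℤ))) 1 := continuousAt_zpow₀ 1 _ (Or.inl one_ne_zero)
    exact ((Real.continuous_exp.comp continuous_neg).continuousAt.mul h2).neg
  have hint : IntegrableOn f' (Ioi 1) := (integrableOn_beta k).add ((integrableOn_beta (k + 1)).const_mul _)
  have hlim : Tendsto f atTop (𝓝 0) := by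
    have hb : ∀ᶠ t in atTop, ‖f t‖ ≤ Real.exp (-t) := by
      filter_upwards [eventually_gt_atTop (1:ℝ)] with t ht
      have ht0 : 0 < t := by linarith
      rw [hf, norm_neg, Real.norm_eq_abs, abs_of_nonneg (mul_nonneg (Real.exp_pos _).le (zpow_nonneg ht0.le _))]
      calc Real.exp (-t) * t ^ (-(k:ℤ)) ≤ Real.exp (-t) * 1 := by
            gcongr; exact zpow_le_one_of_nonpos₀ ht.le (by simp)
        _ = Real.exp (-t) := mul_one _
    exact squeeze_zero_norm' hb Real.tendsto_exp_neg_atTop_nhds_zero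
  have key := integral_Ioi_of_hasDerivAt_of_tendsto hcont hderiv hint hlim
  rw [hf', integral_add (integrableOn_beta k) ((integrableOn_beta (k + 1)).const_mul _), integral_const_mul] at key
  rw [key, hf]
  simp

/-! ## §2  The far parts as alternating series in `p` -/

/-- Algebra of one term: `(−p)^k/k! · t^{−(k+j)} = t^{−j} · (−(p/t))^k/k!` for `t ≠ 0`. -/
theorem far_term_eq (j k : ℕ) (p : ℝ) {t : ℝ} (ht : t ≠ 0) :
    (-p) ^ k / (k.factorial : ℝ) * (Real.exp (-t) * t ^ (-((k + j : ℕ):ℤ)))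
      = Real.exp (-t) * t ^ (-(j:ℤ)) * ((-(p / t)) ^ k / (k.factorial : ℝ)) := by
  have h1 : t ^ (-((k + j : ℕ):ℤ)) = t ^ (-(k:ℤ)) * t ^ (-(j:ℤ)) := by
    rw [← zpow_add₀ ht]; congr 1; push_cast; ring
  have h2 : (-(p / t)) ^ k = (-p) ^ k * t ^ (-(k:ℤ)) := by
    rw [neg_pow, neg_pow p, div_pow, zpow_neg, zpow_natCast, div_eq_mul_inv]
    ring
  rw [h1, h2]
  ring

/-- **THE FAR EXPANSION**: for `p ≥ 0` and all `j n`,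
`0 ≤ (−1)^n·(∫_{(1,∞)} e^{−t} t^{−j} e^{−p/t} dt − Σ_{k<n} (−p)^k/k!·β_{k+j}) ≤ pⁿ/n!·β_{n+j}`. -/
theorem far_expansion (j n : ℕ) {p : ℝ} (hp : 0 ≤ p) :
    0 ≤ (-1 : ℝ) ^ n * ((∫ t in Ioi (1:ℝ), Real.exp (-t) * t ^ (-(j:ℤ)) * Real.exp (-(p / t)))
        - ∑ k ∈ range n, (-p) ^ k / (k.factorial : ℝ) * ∫ t in Ioi (1:ℝ), Real.exp (-t) * t ^ (-((k + j : ℕ):ℤ))) ∧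
    (-1 : ℝ) ^ n * ((∫ t in Ioi (1:ℝ), Real.exp (-t) * t ^ (-(j:ℤ)) * Real.exp (-(p / t)))
        - ∑ k ∈ range n, (-p) ^ k / (k.factorial : ℝ) * ∫ t in Ioi (1:ℝ), Real.exp (-t) * t ^ (-((k + j : ℕ):ℤ)))
      ≤ p ^ n / (n.factorial : ℝ) * ∫ t in Ioi (1:ℝ), Real.exp (-t) * t ^ (-((n + j : ℕ):ℤ)) := by
  -- the sum as ONE integral
  have hterm : ∀ k ∈ range n, IntegrableOn
      (fun t : ℝ => (-p) ^ k / (k.factorial : ℝ) * (Real.exp (-t) * t ^ (-((k + j : ℕ):ℤ)))) (Ioi 1) :=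
    fun k _ => (integrableOn_beta (k + j)).const_mul _
  have hsum : ∑ k ∈ range n, (-p) ^ k / (k.factorial : ℝ) * ∫ t in Ioi (1:ℝ), Real.exp (-t) * t ^ (-((k + j : ℕ):ℤ))
      = ∫ t in Ioi (1:ℝ), ∑ k ∈ range n, (-p) ^ k / (k.factorial : ℝ) * (Real.exp (-t) * t ^ (-((k + j : ℕ):ℤ))) := by
    rw [integral_finsetSum _ hterm]
    refine sum_congr rfl (fun k _ => ?_)
    rw [integral_const_mul]
  have hsumI : IntegrableOn
      (fun t : ℝ => ∑ k ∈ range n, (-p) ^ k / (k.factorial : ℝ) * (Real.exp (-t) * t ^ (-((k + j : ℕ):ℤ)))) (Ioi 1) :=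
    integrable_finsetSum _ hterm
  have hG := integrableOn_far j hp
  -- the difference as ONE integral of `e^{−t} t^{−j} · R(p/t)`
  have hdiff : (∫ t in Ioi (1:ℝ), Real.exp (-t) * t ^ (-(j:ℤ)) * Real.exp (-(p / t)))
      - ∑ k ∈ range n, (-p) ^ k / (k.factorial : ℝ) * ∫ t in Ioi (1:ℝ), Real.exp (-t) * t ^ (-((k + j : ℕ):ℤ))
      = ∫ t in Ioi (1:ℝ), Real.exp (-t) * t ^ (-(j:ℤ)) *
          (Real.exp (-(p / t)) - ∑ k ∈ range n, (-(p / t)) ^ k / (k.factorial : ℝ)) := by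
    rw [hsum, ← integral_sub hG hsumI]
    refine setIntegral_congr_fun measurableSet_Ioi (fun t (ht : 1 < t) => ?_)
    have ht0 : t ≠ 0 := by positivity
    rw [mul_sub, mul_sum]
    congr 1
    exact sum_congr rfl (fun k _ => far_term_eq j k p ht0)
  have hRI : IntegrableOn (fun t : ℝ => Real.exp (-t) * t ^ (-(j:ℤ)) *
      (Real.exp (-(p / t)) - ∑ k ∈ range n, (-(p / t)) ^ k / (k.factorial : ℝ))) (Ioi 1) := by
    refine (hG.sub hsumI).congr_fun (fun t (ht : 1 < t) => ?_) measurableSet_Ioi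
    have ht0 : t ≠ 0 := by positivity
    simp only [Pi.sub_apply]
    rw [mul_sub, mul_sum]
    congr 1
    exact sum_congr rfl (fun k _ => far_term_eq j k p ht0)
  rw [hdiff, ← integral_const_mul]
  -- pointwise sign and size of `(−1)^n · e^{−t} t^{−j} R(p/t)`
  have hpt : ∀ t ∈ Ioi (1:ℝ),
      0 ≤ (-1 : ℝ) ^ n * (Real.exp (-t) * t ^ (-(j:ℤ)) *
        (Real.exp (-(p / t)) - ∑ k ∈ range n, (-(p / t)) ^ k / (k.factorial : ℝ))) ∧
      (-1 : ℝ) ^ n * (Real.exp (-t) * t ^ (-(j:ℤ)) *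
        (Real.exp (-(p / t)) - ∑ k ∈ range n, (-(p / t)) ^ k / (k.factorial : ℝ)))
        ≤ p ^ n / (n.factorial : ℝ) * (Real.exp (-t) * t ^ (-((n + j : ℕ):ℤ))) := by
    intro t ht
    have ht1 : (1:ℝ) < t := ht
    have ht0 : 0 < t := by linarith
    have hy : 0 ≤ p / t := div_nonneg hp ht0.le
    have hw : 0 ≤ Real.exp (-t) * t ^ (-(j:ℤ)) := mul_nonneg (Real.exp_pos _).le (zpow_nonneg ht0.le _)
    have hlo := expTaylor_alternating n (p / t) hy
    have habs := abs_exp_neg_sub_taylor_le n hy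
    have hup : (-1 : ℝ) ^ n * (Real.exp (-(p / t)) - ∑ k ∈ range n, (-(p / t)) ^ k / (k.factorial : ℝ))
        ≤ (p / t) ^ n / (n.factorial : ℝ) := by
      refine le_trans (le_abs_self _) ?_
      rw [abs_mul, abs_pow, abs_neg, abs_one, one_pow, one_mul]
      exact habs
    have hpow : (p / t) ^ n / (n.factorial : ℝ) * (Real.exp (-t) * t ^ (-(j:ℤ)))
        = p ^ n / (n.factorial : ℝ) * (Real.exp (-t) * t ^ (-((n + j : ℕ):ℤ))) := by
      have h1 : t ^ (-((n + j : ℕ):ℤ)) = (t ^ n)⁻¹ * t ^ (-(j:ℤ)) := by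
        rw [show (-((n + j : ℕ):ℤ)) = -(n:ℤ) + -(j:ℤ) by push_cast; ring, zpow_add₀ ht0.ne', zpow_neg, zpow_natCast]
      rw [h1, div_pow]
      field_simp
    constructor
    · have : (-1 : ℝ) ^ n * (Real.exp (-t) * t ^ (-(j:ℤ)) *
          (Real.exp (-(p / t)) - ∑ k ∈ range n, (-(p / t)) ^ k / (k.factorial : ℝ)))
          = (Real.exp (-t) * t ^ (-(j:ℤ))) * ((-1 : ℝ) ^ n *
            (Real.exp (-(p / t)) - ∑ k ∈ range n, (-(p / t)) ^ k / (k.factorial : ℝ))) := by ring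
      rw [this]; exact mul_nonneg hw hlo
    · have : (-1 : ℝ) ^ n * (Real.exp (-t) * t ^ (-(j:ℤ)) *
          (Real.exp (-(p / t)) - ∑ k ∈ range n, (-(p / t)) ^ k / (k.factorial : ℝ)))
          = ((-1 : ℝ) ^ n * (Real.exp (-(p / t)) - ∑ k ∈ range n, (-(p / t)) ^ k / (k.factorial : ℝ)))
            * (Real.exp (-t) * t ^ (-(j:ℤ))) := by ring
      rw [this, ← hpow]
      exact mul_le_mul_of_nonneg_right hup hw
  constructor
  · exact setIntegral_nonneg measurableSet_Ioi fun t ht => (hpt t ht).1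
  · rw [← integral_const_mul]
    refine setIntegral_mono_on (hRI.const_mul _) ((integrableOn_beta (n + j)).const_mul _) measurableSet_Ioi
      fun t ht => (hpt t ht).2

end Series

end Summit.NavierStokesRegularity.NavierStokesRegularity.Theorems.AnalyticStripLiaSymbol

end
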